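/-
Copyright (c) 2026 the pub-hodgecm-mathlib formalisation cell (harness21).  Prover seat hodgecm-mathlib-B-p04 (g61), req618 STAGE 1a «FOUR-FRAME» squad, Track A TIER 2
for the tier-1 socket `U1_Frames` (this seat's unit as assembler): the payment of `stub_U1_exists_axisStable_vertex` — the frame's APARTMENT VERTEX.  2026-09-03.
-/
import Literature.NumberTheory.Automorphic.UnitaryThreeFourFrameEigenframe    -- ★ p854605 (B-p04): `frameProj_mulVec_frame_self`, `frameProj_mulVec_frame_of_pairing_eq_zero`, `isUnit_det_frameMatrix`; brings ★ #0a DEFS-1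
import Literature.NumberTheory.Automorphic.UnitaryLatticeTreeDual              -- ★ (B-p14): `latt_le_stdLattice_iff` (`latt B ≤ 𝒪ᴺ ↔ B` integral)
import HarnessLib

/-!
# (D-RAM) «FOUR-FRAME» road, unit (i), TIER 2: every frame of a four-frame family has an APARTMENT VERTEX — a vertex lattice of `(K³, Φ₃)` stable under all three
# frame projections (payment of `U1_Frames.stub_U1_exists_axisStable_vertex`)

Cell `pub/hodgecm-mathlib` (D-0151), crux H413 = `stmt-HodgeConjecture-24833`, organ (D-RAM) `stub_DyRamCore`, «FOUR-FRAME» road, Track A (LEAD T17-31 (R-9)); tier-1 socket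
`Cruxes/H413/Lines/F0_P3c_DyRamFourFrame/U1_Frames.lean` (assembler B-p04, cand 10a5dd229ab1d31e), stub **`stub_U1_exists_axisStable_vertex`**: for every wild datum
`(σ, ϖ, d, t)`, four-frame family `f`, frame `b` and slot `i` there is a vertex `M` of the ★ lattice graph of `(K³, Φ₃)` with `π_i^{(b)}·M ⊆ M` (`AxisStable ϖ (frameProj σ (f b i)) M 0`).
THIS FILE proves that statement TOKEN FOR TOKEN (`exists_axisStable_vertex`, §3) from the abstract construction (§2, any `σ` with `|σ·| = |·|`, any uniformiser).

THE MATHEMATICS ([BruhatTits1972, §10]: the apartment of the split torus diagonalised by the frame; [Serre1980Trees, II.1.1]).  Let `N_j = ⟨f_j, f_j⟩ ≠ 0`, `|N_j| = exp(m_j)`,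
and rescale `f_j` by `c_j = ϖ^{k_j}`, `k_j = ⌊m_j∕2⌋ + (m_j mod 2)`, so that `|σ(c_j) c_j N_j| = exp(−r_j)`, `r_j = m_j mod 2 ∈ {0, 1}`.  The lattice `M = latt G`, `G` = the
matrix with columns `c_j f_j` (invertible: frame matrix × diagonal), has DIAGONAL Gram matrix `ᵗσ(G) Φ₃ G = diag(σ(c_j) c_j N_j)` (orthogonality of the frame), with entries of
valuation `exp(0)` or `exp(−1)`: so `Gram` and `ϖ·Gram⁻¹` are integral and `|det Gram| = |ϖ|^{r₀+r₁+r₂}` — `M` is a VERTEX of type `r₀ + r₁ + r₂`.  And `π_i G = G E_ii`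
(`π_i (c_j f_j) = δ_ij c_j f_j`, ★ `frameProj_mulVec_frame_*`), so `π_i·M = latt (G E_ii) = G·latt E_ii ⊆ G·𝒪³ = M`.

* §1 `formCongr_apply_eq_pairing` (Gram entries are pairings of columns), `pairing_smul_smul`, `isIntMatrix_diagonal_single`.
* §2 **`exists_axisStable_vertex_of_frame`** (abstract: `|σ·| = |·|`, `|ϖ| = exp(−1)`, `IsFourFrameFamily σ f`).
* §3 **`exists_axisStable_vertex`** — the stub's statement BY TEXT (datum-tied binders; the datum supplies `hvσ`, `hϖ`).

HONEST LABEL: HC_CM is proved only modulo the 7 printed citations (2 remaining named inputs: hLiu418 = stmt-HodgeConjecture-24832, h413 = stmt-HodgeConjecture-24833) until rung 0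
closes; `--supports stmt-HodgeConjecture-24833` helper, count-neutral for the registries; elementary lattice algebra.
-/

noncomputable section

open scoped Valued WithZero Matrix MatrixGroups

namespace Summit.HodgeConjecture.HodgeConjecture.Cruxes.H413.F0P3cDyRamFrameApartmentVertex

open Literature.NumberTheory.Automorphic Literature.NumberTheory.Automorphic.HermitianLattice
  Literature.NumberTheory.Automorphic.UnitaryLatticeTree Literature.NumberTheory.Automorphic.UnitaryThreeFourFrame

variable {K : Type} [Field K] [Valued K ℤᵐ⁰]

/-! ## §1  Three bookkeeping lemmas -/

omit [Valued K ℤᵐ⁰] in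
/-- The entries of the Gram matrix `ᵗσ(T)·H·T` are the pairings of the COLUMNS of `T`. [cite: Jacobowitz1962, §4] -/
theorem formCongr_apply_eq_pairing (σ : K →+* K) (T : GL (Fin 3) K) (H : Matrix (Fin 3) (Fin 3) K) (i j : Fin 3) :
    formCongr σ T H i j = pairing σ H (fun k => (T : Matrix (Fin 3) (Fin 3) K) k i) (fun k => (T : Matrix (Fin 3) (Fin 3) K) k j) := by
  simp only [formCongr, Matrix.mul_apply, Matrix.transpose_apply, Matrix.map_apply, pairing_apply, Finset.sum_mul]
  exact Finset.sum_comm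

omit [Valued K ℤᵐ⁰] in
/-- Sesquilinearity on scalar multiples: `⟨a·x, e·y⟩ = σ(a)·e·⟨x, y⟩`. [cite: Jacobowitz1962, §4] -/
theorem pairing_smul_smul (σ : K →+* K) (H : Matrix (Fin 3) (Fin 3) K) (a e : K) (x y : Fin 3 → K) :
    pairing σ H (a • x) (e • y) = σ a * e * pairing σ H x y := by
  simp only [map_smulₛₗ, LinearMap.smul_apply, smul_eq_mul, RingHom.id_apply]
  ring

/-- The coordinate idempotent `E_ii = diag(δ_i)` is an integral matrix. [cite: Serre1980Trees, II.1.1] -/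
theorem isIntMatrix_diagonal_single (i : Fin 3) : IsIntMatrix (Matrix.diagonal (Pi.single i (1 : K)) : Matrix (Fin 3) (Fin 3) K) := by
  intro x j
  rw [Matrix.diagonal_apply]
  split_ifs with h
  · subst h
    by_cases hxi : x = i
    · subst hxi; rw [Pi.single_eq_same, map_one]
    · rw [Pi.single_eq_of_ne hxi, map_zero]; exact zero_le
  · rw [map_zero]; exact zero_le

/-! ## §2  The apartment vertex of a frame -/

/-- **THE APARTMENT VERTEX**: for `σ` valuation-preserving, `ϖ` a uniformiser and a four-frame family `f` (H7: `Φ₃`-orthogonal, non-zero norms), every frame `b` carries a vertex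
`M = latt G` (`G` = columns `ϖ^{k_j} f_{b,j}` with `|σ(ϖ^{k_j}) ϖ^{k_j} N(f_{b,j})| ∈ {1, |ϖ|}`) of the ★ lattice graph of `(K³, Φ₃)` which is `π_i^{(b)}`-STABLE for the given slot `i`
(indeed for all three).  [cite: BruhatTits1972, §10] [cite: Serre1980Trees, II.1.1] -/
theorem exists_axisStable_vertex_of_frame {σ : K →+* K} (hvσ : ∀ a, Valued.v (σ a) = Valued.v a) {ϖ : K} (hϖ : Valued.v ϖ = WithZero.exp (-1 : ℤ))
    {f : Fin 4 → Fin 3 → (Fin 3 → K)} (hf : IsFourFrameFamily σ f) (b : Fin 4) (i : Fin 3) :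
    ∃ M : Submodule 𝒪[K] (Fin 3 → K), IsVertex σ ϖ ((StdForm.antidiagonal 3).over K) M ∧ AxisStable ϖ (frameProj σ (f b i)) M 0 := by
  classical
  obtain ⟨horth, hnz, -, -, -⟩ := hf b
  have hϖ0 : ϖ ≠ 0 := fun h => by rw [h, map_zero] at hϖ; exact WithZero.zero_ne_coe hϖ
  -- exponents: `|N_j| = exp (m j)`, rescaling exponent `k j`, residue `r j ∈ {0, 1}` with `m j - 2 k j = - r j`
  set Nf : Fin 3 → K := fun j => pairing σ ((StdForm.antidiagonal 3).over K) (f b j) (f b j) with hNf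
  have hN0 : ∀ j, Valued.v (Nf j) ≠ 0 := fun j => (Valuation.ne_zero_iff _).2 (hnz j)
  set m : Fin 3 → ℤ := fun j => WithZero.log (Valued.v (Nf j)) with hm_def
  have hm : ∀ j, Valued.v (Nf j) = WithZero.exp (m j) := fun j => (WithZero.exp_log (hN0 j)).symm
  set k : Fin 3 → ℤ := fun j => m j / 2 + m j % 2 with hk_def
  set r : Fin 3 → ℤ := fun j => m j % 2 with hr_def
  have hr01 : ∀ j, r j = 0 ∨ r j = 1 := fun j => Int.emod_two_eq_zero_or_one (m j)
  have hmk : ∀ j, -(k j) + -(k j) + m j = -(r j) := fun j => by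
    simp only [hk_def, hr_def]
    omega
  -- the scaling factors `c j = ϖ ^ k j`
  set c : Fin 3 → K := fun j => ϖ ^ (k j) with hc_def
  have hc0 : ∀ j, c j ≠ 0 := fun j => zpow_ne_zero _ hϖ0
  have hvc : ∀ j, Valued.v (c j) = WithZero.exp (-(k j)) := fun j => by
    simp only [hc_def]
    rw [map_zpow₀, hϖ, ← WithZero.exp_zsmul, smul_eq_mul, mul_neg, mul_one]
  -- the matrix `G` with columns `c_j • f_{b,j}` and its invertibility
  set G : Matrix (Fin 3) (Fin 3) K := Matrix.of fun x j => c j * f b j x with hG_def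
  have hGcol : ∀ j, (fun x => G x j) = c j • f b j := fun j => funext fun x => by
    simp only [hG_def, Matrix.of_apply, Pi.smul_apply, smul_eq_mul]
  have hGeq : G = (Matrix.of (f b))ᵀ * Matrix.diagonal c := by
    ext x j
    rw [Matrix.mul_diagonal, Matrix.transpose_apply, Matrix.of_apply, hG_def, Matrix.of_apply, mul_comm]
  have hGdet : IsUnit G.det := by
    rw [hGeq, Matrix.det_mul, Matrix.det_diagonal]
    exact (isUnit_det_frameMatrix hf b).mul (isUnit_iff_ne_zero.2 (Finset.prod_ne_zero_iff.2 fun j _ => hc0 j))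
  set g : GL (Fin 3) K := ((Matrix.isUnit_iff_isUnit_det G).2 hGdet).unit with hg_def
  have hg : (g : Matrix (Fin 3) (Fin 3) K) = G := ((Matrix.isUnit_iff_isUnit_det G).2 hGdet).unit_spec
  -- the Gram matrix is diagonal with entries `D j = σ(c j) c j N_j` of valuation `exp (-(r j))`
  set D : Fin 3 → K := fun j => σ (c j) * c j * Nf j with hD_def
  have hGram : formCongr σ g ((StdForm.antidiagonal 3).over K) = Matrix.diagonal D := by
    ext x j
    rw [formCongr_apply_eq_pairing, hg, hGcol x, hGcol j, pairing_smul_smul]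
    by_cases hxj : x = j
    · subst hxj
      rw [Matrix.diagonal_apply_eq]
    · rw [horth x j hxj, mul_zero, Matrix.diagonal_apply_ne _ hxj]
  have hvD : ∀ j, Valued.v (D j) = WithZero.exp (-(r j)) := fun j => by
    simp only [hD_def]
    rw [map_mul, map_mul, hvσ, hvc, hm, ← WithZero.exp_add, ← WithZero.exp_add, hmk]
  have hD0 : ∀ j, D j ≠ 0 := fun j => fun h => by
    have h' := hvD j
    rw [h, map_zero] at h'
    exact WithZero.zero_ne_coe h'
  -- (V1) the Gram matrix is integral
  have hint : IsIntMatrix (formCongr σ g ((StdForm.antidiagonal 3).over K)) := by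
    intro x j
    rw [hGram]
    by_cases hxj : x = j
    · subst hxj
      rw [Matrix.diagonal_apply_eq, hvD, ← WithZero.exp_zero, WithZero.exp_le_exp]
      rcases hr01 x with h | h <;> omega
    · rw [Matrix.diagonal_apply_ne _ hxj, map_zero]
      exact zero_le
  -- (V2) `ϖ · Gram⁻¹` is integral
  have hinv : (formCongr σ g ((StdForm.antidiagonal 3).over K))⁻¹ = Matrix.diagonal fun j => (D j)⁻¹ := by
    rw [hGram]
    apply Matrix.inv_eq_right_inv
    rw [Matrix.diagonal_mul_diagonal, ← Matrix.diagonal_one]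
    congr 1
    funext j
    exact mul_inv_cancel₀ (hD0 j)
  have hint' : IsIntMatrix (ϖ • (formCongr σ g ((StdForm.antidiagonal 3).over K))⁻¹) := by
    intro x j
    rw [hinv, ← Matrix.diagonal_smul]
    by_cases hxj : x = j
    · subst hxj
      rw [Matrix.diagonal_apply_eq, Pi.smul_apply, smul_eq_mul, map_mul, map_inv₀, hϖ, hvD, ← WithZero.exp_neg, neg_neg, ← WithZero.exp_add,
        ← WithZero.exp_zero, WithZero.exp_le_exp]
      rcases hr01 x with h | h <;> omega
    · rw [Matrix.diagonal_apply_ne _ hxj, map_zero]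
      exact zero_le
  -- (V3) the type: `|det Gram| = |ϖ| ^ (r 0 + r 1 + r 2)`
  have hrsum : 0 ≤ r 0 + r 1 + r 2 := by
    rcases hr01 0 with h0 | h0 <;> rcases hr01 1 with h1 | h1 <;> rcases hr01 2 with h2 | h2 <;> omega
  have hdet : Valued.v (formCongr σ g ((StdForm.antidiagonal 3).over K)).det = Valued.v ϖ ^ (r 0 + r 1 + r 2).toNat := by
    rw [hGram, Matrix.det_diagonal, map_prod, Fin.prod_univ_three, hvD, hvD, hvD, ← WithZero.exp_add, ← WithZero.exp_add, hϖ, ← WithZero.exp_nsmul,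
      nsmul_eq_mul, Int.toNat_of_nonneg hrsum]
    congr 1
    ring
  -- (A) `π_i G = G E_ii`
  have hπG : frameProj σ (f b i) * G = G * Matrix.diagonal (Pi.single i (1 : K)) := by
    ext x j
    have hcol : (frameProj σ (f b i) * G) x j = (frameProj σ (f b i) *ᵥ (c j • f b j)) x := by
      rw [← hGcol j]
      simp only [Matrix.mul_apply, Matrix.mulVec, dotProduct]
    rw [hcol, Matrix.mulVec_smul, Matrix.mul_diagonal]
    by_cases hji : j = i
    · subst hji
      rw [frameProj_mulVec_frame_self σ (hnz j), Pi.single_eq_same, mul_one, Pi.smul_apply, smul_eq_mul, hG_def, Matrix.of_apply]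
    · rw [frameProj_mulVec_frame_of_pairing_eq_zero σ (horth i j (Ne.symm hji)), smul_zero, Pi.zero_apply, Pi.single_eq_of_ne hji, mul_zero]
  -- assemble
  refine ⟨latt G, ⟨(r 0 + r 1 + r 2).toNat, g, by rw [hg], hint, hint', hdet⟩, ?_⟩
  show (latt G).map ((Matrix.toLin' (ϖ ^ 0 • frameProj σ (f b i))).restrictScalars 𝒪[K]) ≤ latt G
  rw [pow_zero, one_smul, ← latt_mul, hπG, latt_mul]
  exact Submodule.map_mono ((latt_le_stdLattice_iff _).2 (isIntMatrix_diagonal_single i))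

/-! ## §3  The head: `U1_Frames.stub_U1_exists_axisStable_vertex`, token for token -/

/-- **PAYMENT OF `stub_U1_exists_axisStable_vertex`** (tier-1 socket `U1_Frames`, unit (i)): for every wild ramified quadratic datum `(σ, ϖ, d, t)` on a complete `K`, every
four-frame family `f`, frame `b` and slot `i`, a `π_i^{(b)}`-stable vertex of the lattice graph of `(K³, Φ₃)` exists.  The datum is used only through `|σ·| = |·|` and
`|ϖ| = exp(−1)` (§2). [cite: BruhatTits1972, §10] [cite: Serre1980Trees, II.1.1] -/
theorem exists_axisStable_vertex :
    ∀ {K : Type} [Field K] [Valued K ℤᵐ⁰] [CompleteSpace K] (σ : K →+* K) (ϖ : K) (d t : ℕ), IsRamifiedQuadraticDatum σ ϖ d t →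
      ∀ (f : Fin 4 → Fin 3 → (Fin 3 → K)), IsFourFrameFamily σ f → ∀ (b : Fin 4) (i : Fin 3),
        ∃ (M : Submodule 𝒪[K] (Fin 3 → K)), IsVertex σ ϖ ((StdForm.antidiagonal 3).over K) M ∧ AxisStable ϖ (frameProj σ (f b i)) M 0 :=
  fun _ _ _ _ hD _ hf b i => exists_axisStable_vertex_of_frame hD.2.1 hD.2.2.1 hf b i

end Summit.HodgeConjecture.HodgeConjecture.Cruxes.H413.F0P3cDyRamFrameApartmentVertex

end
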